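import Mathlib
import Literature.Computability.Complexity.Circuit
import HarnessLib

/-!
# Route `PositionalGames`, crux `MpgGeneralSuperpoly` (stmt-PneNP-1292): glue of the registered decomposition
# (crux-strategist, BC2 redirect, FRAME FORM)

The deciding crux `Summit.PneNP.PneNP.Theses.PositionalGames.MpgGeneralSuperpoly` (X, function-level
"MPG ∉ P/poly") is DERIVED from the route's two cruxes

* `MpgMonotoneSuperpoly` (M2, stmt-PneNP-1295): superpolynomial MONOTONE lower bound for some mean-payoff template;
* `MpgNoMonotoneGap` (T-cap, stmt-PneNP-1296): monotone and general (B₂) complexity of EVERY mean-payoff template agree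
  up to a polynomial,

by the arithmetic of the landed glue `Summit.PneNP.PneNP.Theorems.mpgTargetOfCruxes_proof` (item stmt-PneNP-1302,
`Theorems/PositionalGamesMpgTargetOfCruxes.lean`). FRAME FORM: this module must be importable by the route module
`Summits.PneNP.PneNP.Theses.PositionalGames` (for a `--glue-by` link the gate renders
`theorem MpgGeneralSuperpolyGlueBy_holds : MpgMonotoneSuperpoly → MpgNoMonotoneGap → MpgGeneralSuperpoly := _root_.…`
there), so it does NOT import the route module (the landed glue does, hence cannot be linked) and states the three
statements with their bodies INLINED VERBATIM from the route file rev 2, elaborated in the same `open` context; the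
link then typechecks by δ-unfolding only. No definitions, nothing conditional.
-/

set_option linter.dupNamespace false

namespace Summit.PneNP.PneNP.Theorems

open scoped BigOperators Topology Manifold Classical MeasureTheory ProbabilityTheory Matrix InnerProductSpace ComplexConjugate ContinuousMap
open Filter Set Function TopologicalSpace MeasureTheory

/-- The arithmetic core: from `n ^ (c * (k + 1)) < a ≤ n ^ c * b ^ c` conclude `n ^ k < b` (otherwise
`n ^ c * b ^ c ≤ n ^ c * (n ^ k) ^ c = n ^ (c * (k + 1))`). Same statement and proof as
`mpgTargetOfCruxes_arith` of `Theorems/PositionalGamesMpgTargetOfCruxes.lean` (restated: that module imports the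
route file). [folklore] -/
theorem mpgGeneralSuperpoly_split_arith {n c k a b : ℕ} (h₁ : n ^ (c * (k + 1)) < a)
    (h₂ : a ≤ n ^ c * b ^ c) : n ^ k < b := by
  refine lt_of_not_ge fun hb => ?_
  have h₃ : n ^ c * b ^ c ≤ n ^ (c * (k + 1)) := by
    calc n ^ c * b ^ c ≤ n ^ c * (n ^ k) ^ c :=
          Nat.mul_le_mul_left _ (Nat.pow_le_pow_left hb c)
      _ = n ^ (c * (k + 1)) := by
          rw [← pow_mul, ← pow_add]
          congr 1
          ring
  exact lt_irrefl _ (lt_of_lt_of_le h₁ (h₂.trans h₃))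

/-- **Glue of the registered decomposition of `MpgGeneralSuperpoly`** (crux-strategist, 2026-08-17):
`MpgMonotoneSuperpoly → MpgNoMonotoneGap → MpgGeneralSuperpoly`, bodies inlined verbatim (frame form).
Fix `k`; let `c` be the exponent of the no-gap hypothesis and apply the monotone lower bound at exponent
`c * (k + 1)`: for all large `n` some template `(o, v)` has `n ^ (c * (k + 1)) < mSIZE F ≤ n ^ c * SIZE_B2(F) ^ c`,
whence `n ^ k < SIZE_B2(F)` (`mpgGeneralSuperpoly_split_arith`) for all large `n`, in particular frequently.
[folklore] -/
theorem mpgGeneralSuperpoly_of_subs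
    (hM : ∀ k : ℕ, ∀ᶠ n : ℕ in Filter.atTop, ∃ (o : Fin n → Bool) (v : Fin n), n ^ k < Literature.Computability.Complexity.circuitSizeOver Literature.Computability.Complexity.monotoneBasis (fun x : (Fin n × Fin n) ⊕ (Fin n × Fin n) → Bool => decide (∃ σ : Fin n → Fin n, (∀ u, o u = true → x (Sum.inl (u, σ u)) = true) ∧ ∀ τ : Fin n → Fin n, (∀ u, o u = false → x (Sum.inl (u, τ u)) = false) → let C : Finset (Fin n) := Finset.univ.filter fun u : Fin n => ∃ᶠ t : ℕ in Filter.atTop, (fun w : Fin n => if o w = true then σ w else τ w)^[t] v = u; 2 ^ n * C.card ≤ 2 * ∑ u ∈ C, ∑ j : Fin n, if x (Sum.inr (u, j)) = true then 2 ^ (j : ℕ) else 0)))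
    (hT : ∃ c : ℕ, ∀ᶠ n : ℕ in Filter.atTop, ∀ (o : Fin n → Bool) (v : Fin n), let F : ((Fin n × Fin n) ⊕ (Fin n × Fin n) → Bool) → Bool := fun x => decide (∃ σ : Fin n → Fin n, (∀ u, o u = true → x (Sum.inl (u, σ u)) = true) ∧ ∀ τ : Fin n → Fin n, (∀ u, o u = false → x (Sum.inl (u, τ u)) = false) → let C : Finset (Fin n) := Finset.univ.filter fun u : Fin n => ∃ᶠ t : ℕ in Filter.atTop, (fun w : Fin n => if o w = true then σ w else τ w)^[t] v = u; 2 ^ n * C.card ≤ 2 * ∑ u ∈ C, ∑ j : Fin n, if x (Sum.inr (u, j)) = true then 2 ^ (j : ℕ) else 0); Literature.Computability.Complexity.circuitSizeOver Literature.Computability.Complexity.monotoneBasis F ≤ n ^ c * Literature.Computability.Complexity.circuitSizeOver Literature.Computability.Complexity.B2 F ^ c) :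
    ∀ k : ℕ, ∃ᶠ n : ℕ in Filter.atTop, ∃ (o : Fin n → Bool) (v : Fin n), n ^ k < Literature.Computability.Complexity.circuitSizeOver Literature.Computability.Complexity.B2 (fun x : (Fin n × Fin n) ⊕ (Fin n × Fin n) → Bool => decide (∃ σ : Fin n → Fin n, (∀ u, o u = true → x (Sum.inl (u, σ u)) = true) ∧ ∀ τ : Fin n → Fin n, (∀ u, o u = false → x (Sum.inl (u, τ u)) = false) → let C : Finset (Fin n) := Finset.univ.filter fun u : Fin n => ∃ᶠ t : ℕ in Filter.atTop, (fun w : Fin n => if o w = true then σ w else τ w)^[t] v = u; 2 ^ n * C.card ≤ 2 * ∑ u ∈ C, ∑ j : Fin n, if x (Sum.inr (u, j)) = true then 2 ^ (j : ℕ) else 0)) := by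
  intro k
  obtain ⟨c, hc⟩ := hT
  refine Filter.Eventually.frequently ?_
  filter_upwards [hM (c * (k + 1)), hc] with n hn hcn
  obtain ⟨o, v, hlt⟩ := hn
  exact ⟨o, v, mpgGeneralSuperpoly_split_arith hlt (hcn o v)⟩

end Summit.PneNP.PneNP.Theorems
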